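import Literature.AlgebraicGeometry.Shioda1982.ExceptionalQuadruplesSweepEightyThree
import HarnessLib

/-!
# Shioda 1982 / Meyer–Neutsch 1981: no exceptional quadruple is missing at any level `83 < N ≤ 90` (kernel sweep, continued)

Topic `Literature/AlgebraicGeometry/Shioda1982`; continuation of `ExceptionalQuadruplesSweepSixty.lean` (`checkB'`, the sweep for `2 ≤ N ≤ 60`)
and of `ExceptionalQuadruplesComplete.lean` (search `checkB`, soundness `tabelleOneCompleteAt_of_chunks`, invariant form
`exists_mem_reps_of_isExceptionalQuadruple`; sources, method and framing in its module docstring). THEOREMS only: the kernel search at every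
level `83 < N ≤ 90` in 5 separate kernel evaluations, combined with the bound `83` of the previous file into
`checkB'_of_le_ninety`, `tabelleOneCompleteAt_of_le_ninety` (Tabelle 1 complete at EVERY `2 ≤ N ≤ 90`) and
`not_isExceptionalQuadruple_of_le_ninety` (no exceptional quadruple at the levels `≤ 90` absent from the table — here newly the
5 levels 85, 86, 87, 88, 89; the table levels 84, 90 in this range are re-certified in passing).
[MeyerNeutsch1981Fermatquadrupel, §2 p. 53] searched all `N ≤ 614`; [Shioda1982PicardFermat, table p. 727] lists the `m` with a non-zero count; none
of the newly swept levels appears there. No definition, no named fact; `decide +kernel` only (no `native_decide`).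

HONEST FRAMING (cell `pub-hfermat`): explicit algebraic cycles for specific Hodge classes on Fermat/Delsarte varieties; residual open
instances listed; no claim on general Hodge.

## References
* [MeyerNeutsch1981Fermatquadrupel] W. Meyer, W. Neutsch, *Fermatquadrupel*, Math. Ann. 256 (1981) 51–62, §2 p. 53, Tabelle 1 p. 54.
* [Shioda1982PicardFermat] T. Shioda, J. Fac. Sci. Univ. Tokyo IA 28 (1982) 725–734, table p. 727.
-/

namespace Literature.AlgebraicGeometry.Shioda1982

open Literature.AlgebraicGeometry.HodgeTheory

set_option maxHeartbeats 0 in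
/-- The search passes at every level `84 ≤ N ≤ 85`. Kernel evaluation.
[cite: MeyerNeutsch1981Fermatquadrupel, §2 p. 53 ("alle Fermatquadrupel für N ≤ 614 ermittelt") and Tabelle 1 p. 54] -/
theorem checkB'_range_84_85 : ∀ N ∈ List.range' 84 2, checkB' N = true := by
  decide +kernel

set_option maxHeartbeats 0 in
/-- The search passes at every level `86 ≤ N ≤ 87`. Kernel evaluation.
[cite: MeyerNeutsch1981Fermatquadrupel, §2 p. 53 ("alle Fermatquadrupel für N ≤ 614 ermittelt") and Tabelle 1 p. 54] -/
theorem checkB'_range_86_87 : ∀ N ∈ List.range' 86 2, checkB' N = true := by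
  decide +kernel

set_option maxHeartbeats 0 in
/-- The search passes at every level `88 ≤ N ≤ 88`. Kernel evaluation.
[cite: MeyerNeutsch1981Fermatquadrupel, §2 p. 53 ("alle Fermatquadrupel für N ≤ 614 ermittelt") and Tabelle 1 p. 54] -/
theorem checkB'_range_88_88 : ∀ N ∈ List.range' 88 1, checkB' N = true := by
  decide +kernel

set_option maxHeartbeats 0 in
/-- The search passes at every level `89 ≤ N ≤ 89`. Kernel evaluation.
[cite: MeyerNeutsch1981Fermatquadrupel, §2 p. 53 ("alle Fermatquadrupel für N ≤ 614 ermittelt") and Tabelle 1 p. 54] -/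
theorem checkB'_range_89_89 : ∀ N ∈ List.range' 89 1, checkB' N = true := by
  decide +kernel

set_option maxHeartbeats 0 in
/-- The search passes at every level `90 ≤ N ≤ 90`. Kernel evaluation.
[cite: MeyerNeutsch1981Fermatquadrupel, §2 p. 53 ("alle Fermatquadrupel für N ≤ 614 ermittelt") and Tabelle 1 p. 54] -/
theorem checkB'_range_90_90 : ∀ N ∈ List.range' 90 1, checkB' N = true := by
  decide +kernel

/-- The search passes at every level `2 ≤ N ≤ 90`. [cite: MeyerNeutsch1981Fermatquadrupel, §2 p. 53] -/
theorem checkB'_of_le_ninety (N : ℕ) (h2 : 2 ≤ N) (h : N ≤ 90) : checkB' N = true := by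
  rcases Nat.lt_or_ge N 84 with g0 | g0
  · exact checkB'_of_le_eightyThree N h2 (by omega)
  rcases Nat.lt_or_ge N 86 with g1 | g1
  · exact checkB'_range_84_85 N (List.mem_range'_1.mpr ⟨g0, by omega⟩)
  rcases Nat.lt_or_ge N 88 with g2 | g2
  · exact checkB'_range_86_87 N (List.mem_range'_1.mpr ⟨g1, by omega⟩)
  rcases Nat.lt_or_ge N 89 with g3 | g3
  · exact checkB'_range_88_88 N (List.mem_range'_1.mpr ⟨g2, by omega⟩)
  rcases Nat.lt_or_ge N 90 with g4 | g4
  · exact checkB'_range_89_89 N (List.mem_range'_1.mpr ⟨g3, by omega⟩)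
  · exact checkB'_range_90_90 N (List.mem_range'_1.mpr ⟨g4, by omega⟩)

/-- **Uniform completeness for all `2 ≤ N ≤ 90`:** every sorted Hodge 4-multiset mod `N` without a pair and with `gcd = 1` is
standard or a unit multiple of a representative printed in Tabelle 1 at level `N`.
[cite: MeyerNeutsch1981Fermatquadrupel, §2 p. 53 and Tabelle 1 p. 54] [cite: Shioda1982PicardFermat, table p. 727] -/
theorem tabelleOneCompleteAt_of_le_ninety (N : ℕ) [NeZero N] (h2 : 2 ≤ N) (h : N ≤ 90) : TabelleOneCompleteAt N := by
  refine tabelleOneCompleteAt_of_chunks N [(0, N)]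
    (fun a ha ↦ ⟨(0, N), List.mem_singleton.mpr rfl, Nat.zero_le a, by simpa using ha⟩) ?_
  intro p hp
  rw [List.mem_singleton] at hp
  subst hp
  rw [← checkB'_eq]
  exact checkB'_of_le_ninety N h2 h

/-- **No exceptional quadruple at the levels `2 ≤ N ≤ 90` absent from Tabelle 1** (`tabelleOne N = []`): the zeros of Shioda's
table in this range, kernel-checked. [cite: Shioda1982PicardFermat, table p. 727] [cite: MeyerNeutsch1981Fermatquadrupel, Tabelle 1 p. 54] -/
theorem not_isExceptionalQuadruple_of_le_ninety (N : ℕ) [NeZero N] (h2 : 2 ≤ N) (h : N ≤ 90) (htab : tabelleOne N = [])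
    (s : Multiset (ZMod N)) : ¬ IsExceptionalQuadruple N s := by
  intro hs
  obtain ⟨r, hr, -⟩ := exists_mem_reps_of_isExceptionalQuadruple (tabelleOneCompleteAt_of_le_ninety N h2 h) hs
  simp [reps, htab] at hr

end Literature.AlgebraicGeometry.Shioda1982
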